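import Literature.Geometry.Symplectic.LefschetzSteinOpenBook
import Literature.Topology.FourManifolds.LefschetzBaseOpenBook
import HarnessLib

/-!
# PALF ⇒ Stein with supported boundary open book: the handle-free base case
# (non-vacuity of the hypotheses of `palf_stein_supportedByBoundaryOpenBook`, and its
# specialisation to `∂(F_{g,1} × D²)`)

Topic `Literature/Geometry/Symplectic`; a proofs-only companion of `LefschetzSteinOpenBook.lean`
(the named fact `Literature.Geometry.Symplectic.palf_stein_supportedByBoundaryOpenBook`,
Akbulut–Ozbagci 2001, Thm. 5 with Gay 2002, Prop. 2.8).  Everything here is PROVED; no named fact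
is introduced (D-0026).

The fact quantifies over Kosinski multi-attachments `D : MultiAttachmentData h (𝓡∂ 4) X` of a
family `h` of 2-handle attaching maps on the standard base `Base g ⊂ ℂ²` and over open books `ob`
pinned to the Kas boundary open book by `IsKasOpenBookOf`.  This file records the simplest
inhabitant of these hypotheses and the corresponding special case of the fact:

* `exists_multiAttachmentData_isKasOpenBookOf_base` — for the EMPTY family of handles
  (`h₀ : Empty → HandleAttachingMap 3 2 (Base g)`), the base itself is the attached manifold
  (`X = Base g`, `jA` the inclusion of the cores-complement, which is all of `Base g`), and the
  boundary open book `LefschetzBase.boundaryOpenBook g` of `LefschetzBaseOpenBook.lean` (binding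
  `{w = 0} ∩ ∂ Base g`, fibration `w/‖w‖`) IS the Kas open book of this trivial Lefschetz
  handlebody in the sense of `IsKasOpenBookOf`.  In particular the hypotheses of the fact are
  satisfiable for every genus `g` (the three clauses on the attaching circles are vacuous over
  `Empty`), so the fact is not vacuously true: any discharge must produce a Stein structure.
* `palf_stein_supportedByBoundaryOpenBook.base_case` — the fact, specialised to this inhabitant:
  **`Base g` (on paper `F_{g,1} × D²`) carries a Stein structure whose complex tangencies on
  `∂ Base g` admit a Giroux form for the trivial open book `boundaryOpenBook g` and are positive
  for the complex boundary orientation** — the statement which `LefschetzBaseOpenBook.lean`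
  ("What is NOT here") describes as the separate contact-topological input over that vocabulary
  (Torisu 2000; Etnyre 2006, §5, the open book of `#^{2g} S¹ × S²` with page `F_{g,1}` and trivial
  monodromy supports the Stein fillable contact structure of `∂(F_{g,1} × D²)`; Akbulut–Ozbagci
  2001, proof of Thm. 5, first step "`X₀ = D² × F` … Stein").  Here it is a COROLLARY of the named
  fact (hypothesis `hfact`), not a new fact.

## References
* S. Akbulut, B. Ozbagci, *Lefschetz fibrations on compact Stein surfaces*, Geom. Topol. 5
  (2001), 319–334, Thm. 5 and its proof (arXiv:math/0012239, p. 8). [AkbulutOzbagci2001]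
* J. B. Etnyre, *Lectures on open book decompositions and contact structures*, Clay Math. Proc. 5
  (2006), §2 (Example `∂(F × D²)`), §5. [Etnyre2006]
* I. Torisu, *Convex contact structures and fibered links in 3-manifolds*, IMRN 2000:9, 441–454.
-/

noncomputable section

open scoped Manifold ContDiff Topology
open Set Function

namespace Literature.Geometry.Symplectic

open Literature.Topology.FourManifolds Literature.Topology.FourManifolds.HandleAttachingMap
  Literature.Topology.FourManifolds.LefschetzBase

/-- **The base with no handles is its own (trivial) Lefschetz handlebody, and its boundary open
book is the Kas open book.**  For the empty family `h₀` of attaching maps on `Base g` there is a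
multi-attachment datum `D` on `X = Base g` whose base embedding `D.jA` is the inclusion of the
cores-complement (all of `Base g`, there being no cores), and the boundary open book
`LefschetzBase.boundaryOpenBook g` (`LefschetzBaseOpenBook.lean`: binding `{w = 0} ∩ ∂ Base g`,
fibration `w / ‖w‖`) satisfies both clauses of `IsKasOpenBookOf` for it on the boundary datum
`bBase g`.  (Non-vacuity of the hypotheses of `palf_stein_supportedByBoundaryOpenBook`.)
[folklore] -/
theorem exists_multiAttachmentData_isKasOpenBookOf_base (g : ℕ)
    (h₀ : Empty → HandleAttachingMap 3 2 (Base g)) :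
    ∃ D : MultiAttachmentData h₀ (𝓡∂ 4) (Base g),
      D.jA = Subtype.val ∧ IsKasOpenBookOf g h₀ D (bBase g).incl (boundaryOpenBook g) := by
  classical
  -- every point of the base lies in the cores-complement of the empty family
  have hmem : ∀ a : Base g, a ∈ coresComplement h₀ := fun a =>
    (mem_coresComplement h₀).2 fun i => i.elim
  let D : MultiAttachmentData h₀ (𝓡∂ 4) (Base g) :=
    { disjoint := fun i => i.elim
      jA := Subtype.val
      jB := fun i => i.elim
      hjA := Manifold.IsSmoothEmbedding.of_opens _
      hjAo := (coresComplement h₀).isOpenEmbedding'.isOpen_range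
      hjB := fun i => i.elim
      cover := by
        refine eq_univ_of_forall fun a => Or.inl ?_
        exact ⟨⟨a, hmem a⟩, rfl⟩
      glue := fun i => i.elim
      disjointB := fun i => i.elim }
  refine ⟨D, rfl, ?_, ?_⟩
  · -- (K1) the binding is the image of `{w = 0} ∩ ∂ Base g`
    intro y
    rw [mem_binding_boundaryOpenBook_iff]
    constructor
    · intro hw
      exact ⟨⟨(bBase g).incl y, hmem _⟩, rfl, hw⟩
    · rintro ⟨a, ha, hw⟩
      have : (bBase g).incl y = (a : Base g) := ha
      rw [this]
      exact hw
  · -- (K2) off the binding the fibration is the page angle `w / ‖w‖`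
    intro y a hya hw
    have hya' : (bBase g).incl y = (a : Base g) := hya
    have hw' : w g ((bBase g).incl y).1 ≠ 0 := by rw [hya']; exact hw
    have hproj := proj_boundaryOpenBook g y hw'
    rw [hya'] at hproj
    show toC (((boundaryOpenBook g).proj y : Metric.sphere (0 : EuclideanSpace ℝ (Fin 2)) 1) :
        EuclideanSpace ℝ (Fin 2)) = _
    rw [hproj, toC_smul, toC_vec2, Complex.ofReal_inv]
    exact (div_eq_inv_mul _ _).symm

/-- **The base case of PALF ⇒ Stein with supported boundary open book** (Akbulut–Ozbagci 2001,
proof of Thm. 5, first step; Torisu 2000; Etnyre 2006, §5): under the named fact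
`palf_stein_supportedByBoundaryOpenBook`, the standard base `Base g ⊂ ℂ²` (on paper
`F_{g,1} × D²`, the PALF with no singular fibre) carries a Stein structure `S` whose complex
tangencies `ξ = boundaryPlaneField S.J (bBase g)` on `∂ Base g` admit a Giroux form `α` for the
trivial boundary open book `LefschetzBase.boundaryOpenBook g` (page `F_{g,1}`, binding `{w = 0}`,
fibration `w/‖w‖`), with `ξ` POSITIVE for the boundary orientation of the complex orientation:
`α ∧ dα > 0` on every frame of `T_y ∂ Base g` corresponding under `d(incl)` to a positively
oriented boundary frame of `∂ Base g ⊂ ℂ²`.  Obtained by feeding the trivial multi-attachment of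
`exists_multiAttachmentData_isKasOpenBookOf_base` to the fact; a corollary, not a new fact.
[cite: AkbulutOzbagci2001, Thm. 5] -/
theorem palf_stein_supportedByBoundaryOpenBook.base_case
    (hfact : palf_stein_supportedByBoundaryOpenBook) (g : ℕ)
    (h₀ : Empty → HandleAttachingMap 3 2 (Base g)) :
    ∃ (S : SteinStructure (Base g)) (α : Literature.Geometry.Kaehler.MForm (𝓡 3) (bBase g).carrier ℝ 1),
      (boundaryOpenBook g).IsGirouxForm (boundaryPlaneField S.J (bBase g)) α ∧
      ∀ (y : (bBase g).carrier) (a : ↥(coresComplement h₀)) (u : Fin 3 → EuclideanSpace ℝ (Fin 3))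
        (v : Fin 3 → EuclideanSpace ℝ (Fin 4)),
        (bBase g).incl y = (a : Base g) →
        (∀ k, mfderiv (𝓡 3) (𝓡∂ 4) (bBase g).incl y (u k) =
          mfderiv (𝓡∂ 4) (𝓡∂ 4) (Subtype.val : ↥(coresComplement h₀) → Base g) a (v k)) →
        IsPosBdryFrame h₀ a v →
        0 < wedge₁₂ (α y) (Literature.Geometry.Kaehler.mextDeriv α y) (u 0) (u 1) (u 2) := by
  obtain ⟨D, hjA, hK⟩ := exists_multiAttachmentData_isKasOpenBookOf_base g h₀
  obtain ⟨S, α, hG, hpos⟩ := hfact g Empty (Base g) h₀ D (bBase g) (boundaryOpenBook g)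
    (fun i => i.elim) (fun i => i.elim) (fun i => i.elim) hK
  refine ⟨S, α, hG, fun y a u v hya hd hfr => hpos y a u v ?_ ?_ hfr⟩
  · rw [hjA]; exact hya
  · intro k; rw [hjA]; exact hd k

end Literature.Geometry.Symplectic

end
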